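import Mathlib.AlgebraicGeometry.Morphisms.ClosedImmersion
import Mathlib.CategoryTheory.Monoidal.Cartesian.Grp
import Mathlib.RingTheory.Spectrum.Prime.Topology
import HarnessLib

/-!
# A connected scheme meeting the unit component of a group scheme lies in it; spectra of local rings are connected

Topic `Literature/AlgebraicGeometry/GroupSchemes`; namespace `Literature.AlgebraicGeometry.GroupSchemes`.  THEOREMS ONLY (no definition,
no named fact, no instance, no notation, no `sorry`; Mathlib-only imports).  Cell `hodgecm-mathlib` (D-0151), FLOOR 0, P6 «MOD programme»
generic organ (o-c2d) «CONNECTED ⊂ UNIT COMPONENT» of the P6c desk's CENSUS-DICT v0 §4, in the currency of the P6b sub-line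
`F0_P6b_ConnectedEtale` (`IsUnitComponent G G₀ j` = `j` a homomorphism whose underlying map is an OPEN AND CLOSED immersion with connected
source; the clopen hypotheses are taken EXPLICITLY here).  `--supports stmt-HodgeConjecture-24832`; COUNT-NEUTRAL: HC_CM is proved only
modulo the 7 printed citations until rung 0 closes; this file discharges none of them.

THE PRINT.  [Tate1997FiniteFlatGroupSchemes] (3.7) (I): over a henselian local base the unit component `G⁰` of a finite group scheme is
open and closed, and a connected closed subgroup (e.g. one whose special fibre is a point) lies in `G⁰`; [StacksProject] Tag 04GG
(finite algebras over henselian local rings are products of local rings; a local ring has connected spectrum).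

WHAT IS HERE:
* §1 `range_subset_of_connectedSpace`, **`existsUnique_fac_of_connectedSpace`** — `j : G₀ ⟶ G` over `S` with `j.left` an open and
  closed immersion, `t : T ⟶ G` with `T.left` connected and ONE point mapping into `range j.left` ⇒ `∃! t₀ : T ⟶ G₀, t₀ ≫ j = t`
  (clopen preimage + Mathlib `IsOpenImmersion.lift`);
* §2 `unit_mem_range`, **`existsUnique_fac_hom`** (a homomorphism from a group scheme with connected underlying space factors uniquely
  through the unit component, the base having a point), `isMonHom_of_comp` (the factor is a homomorphism, `j` mono);
* §3 **`connectedSpace_primeSpectrum_of_isLocalRing`**, **`isLocalRing_of_isLocalRing_quotient_map_maximalIdeal`** (a module-finite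
  algebra over a local ring with local special fibre `B ⧸ 𝔪B` is local — its maximal ideals lie over `𝔪`) — together: a finite `Spec R`-group
  scheme whose special fibre is a point has connected underlying space, hence (§2) lies in any unit component.

## References
* [Tate1997FiniteFlatGroupSchemes] J. Tate, *Finite flat group schemes*, in *Modular Forms and Fermat's Last Theorem* (1997) — (3.7) (I).
* [StacksProject] The Stacks Project — Tag 04GG (Algebra, Lemma 10.153.3).
-/

noncomputable section

universe u

open CategoryTheory CategoryTheory.Limits AlgebraicGeometry MonoidalCategory CartesianMonoidalCategory
open scoped MonObj

namespace Literature.AlgebraicGeometry.GroupSchemes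

/-! ## §1 Factoring a morphism from a connected scheme through an open-and-closed immersion -/

section Clopen

variable {S : Scheme.{u}} {G G₀ T : Over S} (j : G₀ ⟶ G) [IsOpenImmersion j.left] [IsClosedImmersion j.left]

omit [IsOpenImmersion j.left] in
/-- The image of an open and closed immersion meets a CONNECTED scheme mapping to `G` either not at all or entirely: if one point
of `T` maps into `range j` then all of `T` does. [cite: Tate1997FiniteFlatGroupSchemes, (3.7)] -/
theorem range_subset_of_connectedSpace [IsOpenImmersion j.left] [ConnectedSpace T.left] (t : T ⟶ G) (x : T.left)
    (hx : t.left x ∈ Set.range j.left) : Set.range t.left ⊆ Set.range j.left := by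
  have hclopen : IsClopen (t.left ⁻¹' Set.range j.left) :=
    ⟨(j.left.isClosedEmbedding.isClosed_range).preimage t.left.continuous,
      (IsOpenImmersion.isOpen_range j.left).preimage t.left.continuous⟩
  have huniv : t.left ⁻¹' Set.range j.left = Set.univ := hclopen.eq_univ ⟨x, hx⟩
  rintro _ ⟨y, rfl⟩
  have : y ∈ t.left ⁻¹' Set.range j.left := by rw [huniv]; trivial
  exact this

/-- **A morphism from a CONNECTED `S`-scheme into `G` meeting the image of an open-and-closed immersion `j : G₀ ↪ G` factors through
`G₀`** (over `S`), uniquely. [cite: Tate1997FiniteFlatGroupSchemes, (3.7)] -/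
theorem existsUnique_fac_of_connectedSpace [ConnectedSpace T.left] (t : T ⟶ G) (x : T.left) (hx : t.left x ∈ Set.range j.left) :
    ∃! t₀ : T ⟶ G₀, t₀ ≫ j = t := by
  have hr := range_subset_of_connectedSpace j t x hx
  let l : T.left ⟶ G₀.left := IsOpenImmersion.lift j.left t.left hr
  have hl : l ≫ j.left = t.left := IsOpenImmersion.lift_fac j.left t.left hr
  refine ⟨Over.homMk l (by rw [← Over.w j, ← Category.assoc, hl, Over.w t]), ?_, fun t₁ ht₁ => ?_⟩
  · ext; exact hl
  · ext
    change t₁.left = l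
    exact IsOpenImmersion.lift_uniq j.left t.left hr t₁.left (by rw [← Over.comp_left, ht₁])

end Clopen

/-! ## §2 Homomorphisms from connected group schemes land in the unit component -/

section Hom

variable {S : Scheme.{u}} {G G₀ H : Over S} [GrpObj G] [GrpObj G₀] [GrpObj H] (j : G₀ ⟶ G) [IsMonHom j]
  [IsOpenImmersion j.left] [IsClosedImmersion j.left]

omit [IsOpenImmersion j.left] [IsClosedImmersion j.left] in
/-- A homomorphism from a group scheme with CONNECTED underlying space meets the unit component: its unit maps to the unit of `G`,
which lies in the image of `j` (`η[G₀] ≫ j = η[G]`). [cite: Tate1997FiniteFlatGroupSchemes, (3.7)] -/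
theorem unit_mem_range (h : H ⟶ G) [IsMonHom h] (s : (𝟙_ (Over S)).left) :
    h.left ((η[H] : 𝟙_ (Over S) ⟶ H).left s) ∈ Set.range j.left := by
  refine ⟨(η[G₀] : 𝟙_ (Over S) ⟶ G₀).left s, ?_⟩
  change ((η[G₀] : 𝟙_ (Over S) ⟶ G₀) ≫ j).left s = ((η[H] : 𝟙_ (Over S) ⟶ H) ≫ h).left s
  rw [IsMonHom.one_hom, IsMonHom.one_hom]

/-- **A HOMOMORPHISM from a group scheme `H` with connected underlying space (over a base `S` with a point) into `G` factors
UNIQUELY through any unit component `j : G₀ ↪ G`** (open-and-closed immersion, homomorphism).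
[cite: Tate1997FiniteFlatGroupSchemes, (3.7)] -/
theorem existsUnique_fac_hom [ConnectedSpace H.left] [Nonempty (𝟙_ (Over S)).left] (h : H ⟶ G) [IsMonHom h] :
    ∃! h₀ : H ⟶ G₀, h₀ ≫ j = h := by
  obtain ⟨s⟩ := (inferInstance : Nonempty (𝟙_ (Over S)).left)
  exact existsUnique_fac_of_connectedSpace j h _ (unit_mem_range j h s)

omit [IsOpenImmersion j.left] [IsClosedImmersion j.left] in
/-- The factor of a homomorphism through the (mono, homomorphic) unit component is a HOMOMORPHISM.
[cite: Tate1997FiniteFlatGroupSchemes, (3.7)] -/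
theorem isMonHom_of_comp [Mono j] (h₀ : H ⟶ G₀) [IsMonHom (h₀ ≫ j)] : IsMonHom h₀ where
  one_hom := by
    rw [← cancel_mono j, Category.assoc, IsMonHom.one_hom (f := h₀ ≫ j), IsMonHom.one_hom]
  mul_hom := by
    rw [← cancel_mono j, Category.assoc, IsMonHom.mul_hom (f := h₀ ≫ j), Category.assoc, IsMonHom.mul_hom,
      ← Category.assoc, tensorHom_comp_tensorHom]

end Hom

/-! ## §3 Finite local ⇒ connected: the spectrum of a local ring is connected; a finite algebra over a local ring with local
special fibre is local -/

/-- **The prime spectrum of a local ring is CONNECTED** (an open set containing the closed point is everything, since every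
point specialises to the closed point). [cite: StacksProject, Tag 04GG] -/
theorem connectedSpace_primeSpectrum_of_isLocalRing (R : Type u) [CommRing R] [IsLocalRing R] :
    ConnectedSpace (PrimeSpectrum R) := by
  -- an open set containing the closed point contains every point (each point specialises to the closed point)
  haveI : PreconnectedSpace (PrimeSpectrum R) :=
    ⟨fun U V hU hV hUV ⟨x, _, hxU⟩ ⟨y, _, hyV⟩ => by
      rcases hUV (Set.mem_univ (IsLocalRing.closedPoint R)) with hc | hc
      · exact ⟨y, Set.mem_univ _, (IsLocalRing.specializes_closedPoint y).mem_open hU hc, hyV⟩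
      · exact ⟨x, Set.mem_univ _, hxU, (IsLocalRing.specializes_closedPoint x).mem_open hV hc⟩⟩
  exact { toNonempty := ⟨IsLocalRing.closedPoint R⟩ }

/-- **A module-finite algebra `B` over a local ring `R` whose special fibre `B ⧸ 𝔪B` is local is LOCAL**: every maximal ideal of
`B` lies over `𝔪` (integrality), hence corresponds to a maximal ideal of `B ⧸ 𝔪B`, and there is only one.
[cite: StacksProject, Tag 04GG] -/
theorem isLocalRing_of_isLocalRing_quotient_map_maximalIdeal {R B : Type u} [CommRing R] [IsLocalRing R] [CommRing B]
    [Algebra R B] [Module.Finite R B] [Nontrivial B]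
    (hloc : IsLocalRing (B ⧸ (IsLocalRing.maximalIdeal R).map (algebraMap R B))) : IsLocalRing B := by
  set I := (IsLocalRing.maximalIdeal R).map (algebraMap R B) with hI
  refine IsLocalRing.of_unique_max_ideal ?_
  -- every maximal ideal of `B` contains `𝔪B`
  have hle : ∀ 𝔫 : Ideal B, 𝔫.IsMaximal → I ≤ 𝔫 := by
    intro 𝔫 h𝔫
    haveI := h𝔫
    have hc : (𝔫.comap (algebraMap R B)).IsMaximal := Ideal.isMaximal_comap_of_isIntegral_of_isMaximal 𝔫
    rw [hI, Ideal.map_le_iff_le_comap, ← IsLocalRing.eq_maximalIdeal hc]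
  -- the unique maximal ideal of `B ⧸ 𝔪B` pulled back to `B`
  let 𝔪₀ : Ideal B := (IsLocalRing.maximalIdeal (B ⧸ I)).comap (Ideal.Quotient.mk I)
  have h𝔪₀ : 𝔪₀.IsMaximal := Ideal.comap_isMaximal_of_surjective _ Ideal.Quotient.mk_surjective
  refine ⟨𝔪₀, h𝔪₀, fun 𝔫 h𝔫 => ?_⟩
  -- `𝔫 ⊇ 𝔪B`, so `𝔫 = comap (map 𝔫)` and `map 𝔫` is THE maximal ideal of the local ring `B ⧸ 𝔪B`
  have h1 : 𝔫 = (𝔫.map (Ideal.Quotient.mk I)).comap (Ideal.Quotient.mk I) := by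
    rw [Ideal.comap_map_of_surjective _ Ideal.Quotient.mk_surjective, ← RingHom.ker_eq_comap_bot, Ideal.mk_ker,
      sup_eq_left.mpr (hle 𝔫 h𝔫)]
  have h2 : (𝔫.map (Ideal.Quotient.mk I)).IsMaximal := by
    have hne : 𝔫.map (Ideal.Quotient.mk I) ≠ ⊤ := by
      intro htop
      apply h𝔫.ne_top
      rw [h1, htop, Ideal.comap_top]
    exact (Ideal.map_eq_top_or_isMaximal_of_surjective _ Ideal.Quotient.mk_surjective h𝔫).resolve_left hne
  conv_lhs => rw [h1]
  rw [IsLocalRing.eq_maximalIdeal h2]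

end Literature.AlgebraicGeometry.GroupSchemes

end
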